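import Literature.MathematicalPhysics.QuantumFieldTheory.Balaban1983to89.B16Overhang

/-!
# `Balaban1983to89.B16OverhangN` — [Balaban1989LargeFieldII] pp. 386–387, (1.85)–(1.88): the dead overhang of an
`N`-ARY merger, amortised by COALESCENCE.  For a merger `Z = ⋃_{x ∈ S} B_x` of finitely many pieces (old components
`Z_j^{(n)}` and new large field regions `Z_{j+1}^{(i)}` joined into one component of `Z_{j+1}`, p. 386), the cubes of
`S^{m}(Z)` outside the iterates of the pieces still ALIVE at step `m`, summed over any horizon, are at most a FEE per
piece, plus a fee per scale of the merged horizon, plus an ARBITRARILY SMALL multiple of the total size of the pieces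
(cell `STEP.md` §7.11 (4) / §11 row O-F4: the binder `hover` = (G-AMORT) of `Step.Budget.controlsAm_merge`,
`…StepInhabited` Part N, for GENERAL `|S|`, in cube currency with unit weights; `GAPS.md` rows G-b02g11-1 / C-b02g11-3;
`DIVERGENCE.md` D-b02g11.1; unit b2b-balaban-b02, gen 11 — NEW leaf module, imports `…B16Overhang` and modifies
nothing).

v1.1 (DOCFIX, docstring-only; every declaration byte-unchanged): (1.88) is quoted VERBATIM here (v1 deferred to
`…B16Overhang` v1, whose quotation was a paraphrase — cross-read C-ref6g21-1 V1) and one READING sentence that echoed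
the paraphrased remainder is re-worded to print's `O(1)2(100M)^dR^{d+2}_{j+1}`.
v1.2 (DOCFIX, docstring-only; every declaration byte-unchanged): p. 386's dummy index of the OLD components restored
to print's `Z_j^{(n)}` (three quotations + l. 6; cross-read C-pv12g11-2 m1, renders re-read as images by gen 12) and
the two READING sentences on the per-merger fee aligned with the theorems' exact constants (C-pv12g11-2 R2).

CITATION HEADER (lean-in-tree rule 2026-08-18).  Source under audit: T. Bałaban, *Large field renormalization. II.
Localization, exponentiation, and bounds for the 𝐑 operation*, Commun. Math. Phys. **122**, 355–392 (1989)
[Balaban1989LargeFieldII] (cell paper B16; held `paper:balaban1989-cmp122-large-field-ii`, journal page = PDF page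
+ 354; pp. 386–387 = PDF 32–33 materialised with `lit read … --pages 32-33`).  The passage adjudicated (p. 386 ll. 4–8,
20–31, p. 387 ll. 4–16; the typist's transcription of the scanned text, mathematical symbols restored from context):
*"In the second case Z is obtained from some number of components of Z_j, and some number of new large field regions,
joined together into the one component of Z_{j+1} by the operations of the last step, in particular by adding layers of
MR_{j+1}-cubes. Denote the components of Z_j by Z_j^{(n)}, and the new large field regions by Z_{j+1}^{(i)}. … We show
that this number satisfies (1.80) by an induction with respect to the number of domains in {Z_j^{(n)}, Z_{j+1}^{(i)}}.
… Define the graph G in the following way: the set of vertices of G is {Z_j^{(n)}, Z_{j+1}^{(i)}}, and a pair of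
domains is a line in G if the union of corresponding domains in (1.84) is a connected domain, i.e., if the
corresponding domains intersect, or touch each other. By (1.84) the graph G is connected. Take a maximal tree graph
contained in the graph G. … Take one of [its endpoints], and denote the corresponding domain in (1.84) by X. Remove the
vertex, and the connecting line, from the graph. … Denote this domain by Y. … The domains X, Y determine the
corresponding indices K₁, K₂. … The domain S^{K₁}(X) satisfies the conditions (i), (ii), in particular it is contained
in a cube of the size 100MR_{j+1+K₁}, and it intersects the domains S^{K₁}(Y). It is clear that applying n₁ times the
operation S to the last domain, where n₁ is a rather small number, e.g., n₁ < 10, we obtain the domain S^{K₁+n₁}(Y)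
containing S^{K₁+n₁}(X). This implies that S^{n−j−1}(Z) = S^{n−j−1}(Y) for n ≧ j + 1 + K₁ + n₁, and that
K ≦ K₂ + n₁ + R_{j+1}."*, with (1.88) (x2 render p033 READ AS AN IMAGE; VERBATIM, as in the header of `…B16Overhang`
v1.1): *"Σ_{n=j+2}^{j+1+K} O(1)M^dR^{d+1}_{j+1}d′_n(S^{n−j−1}(Z)) ≦ Σ_{n=j+2}^{j+1+K₁+n₁} O(1)M^dR^{d+1}_{j+1}d′_n(S^{n−j−1}(X))
+ Σ_{n=j+2}^{j+1+K₂+n₁+R_{j+1}} O(1)M^dR^{d+1}_{j+1}d′_n(S^{n−j−1}(Y)) ≦ κ_{j+1}(X) + κ_{j+1}(Y) + O(1)2(100M)^dR^{d+2}_{j+1}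
≦ κ_{j+1}(Z) − 2(1 + β₀)^{−1}p₀(g_{j+1}) + O(1)3(100M)^dR^{d+2}_{j+1} ≦ κ_{j+1}(Z), (1.88) for p₀ large and γ small
enough."* (printed weights: the CONSTANT `O(1)M^dR^{d+1}_{j+1}`).  The paper is a manuscript UNDER
ADJUDICATION by the audit cell `pub-balaban`: NOTHING printed in it is asserted here; every `theorem` below is finite
combinatorics on `ℤᵈ` and elementary real arithmetic, proved without `sorry` and without new axioms, over the EXISTING
definitions `B13ScaleTransfer.{Pt, block, collar, coarse, closureIdx, Linked, FaceConnected}`, `TreeLength.treeLen`,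
`B16SProfile.{box, Sop, Siter, Qprod, ratio, DropCtl}`, `B16MergeGeometry.{Touch, TouchStep, TouchConnected}`,
`B16Absorption.{pbox, env, envLo, shrink, width}`, `B16StoppingRule.{CondI, StopAt}`, using BY NAME
`B16Overhang.{side_le_281, one_le_treeLen_of_not_condI, two_pow_le_of_not_condI, not_condI_find_sub,
le_add_div_of_two_pow_le}`, `B16MergeHorizon.{Siter_add, ratio_shift_fun, dropCtl_shift, near_of_condI_touch,
altGain_ratio}`, `B16Absorption.{Siter_subset_pbox_of_near, env_sub_envLo_le_width, iterate_collar_singleton_subset_box}`,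
`B16MergeGeometry.{Touch.refl, touch_coarse}`, `B16SProfile.{closureIdx_one, closureIdx_closureIdx,
closureIdx_Qprod_succ, Qprod_succ, Qprod_pos, Siter_biUnion, Siter_nonempty, Sop_nonempty, subset_iterate_collar,
iterate_collar_biUnion, faceConnected_iterate_collar, card_box, mem_box, half_pow_mul_treeLen_ge, ratio_pos}`,
`B13ScaleTransfer.{faceConnected_closureIdx, closureIdx_nonempty, linked_block_center, block_subset_collar,
mem_block}`, `TreeLength.{card_le_treeLen, treeLen_le_card_sub_one, treeLen_nonneg}`.  The three `def`s (`deadU`,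
`anchors`, `overhangN`: the dead union, its anchor set, the `N`-ary dead overhang profile in cube currency) are CELL
BOOKKEEPING, NOT PRINTED NOTIONS (print asserts there is no overhang).

CONTEXT (cell, not print).  Print bounds the merger by a LEAF INDUCTION over a spanning tree of `G` (binary steps
`Z = X ∪ Y`, `X` a leaf), each step using the absorption sentence REFUTED in `…B16Absorption` (`no_uniform_absorption`)
and repaired with an overhang in `…B16MergeHorizon` / `…B16Overhang` (binary, `|S| = 2`).  Summing binary overhang
bounds along the leaf induction charges EVERY dead piece a duration `~ log₂ treeLen(partner)` — for many small pieces
on one large partner this exceeds any budget `η·Σ sizes + (|S|−1)·Fee` (`GAPS.md` G-b02g11-1 (a)).  THIS MODULE proves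
the `N`-ary bound DIRECTLY, with no induction over pieces, by COALESCENCE: a dead piece's iterate lies in a box of
radius `280` about the coarse image of ANY of its cubes (Part 2), so at step `m` the dead union costs at most `561^d`
per ANCHOR (distinct coarse image of a chosen cube per dead piece, Part 3), and the number of anchors is at most BOTH
the number of dead pieces (fee side) AND the number of cubes of the cover `Z^{(m)}` of the merged body, which decays
like `2^d(16·treeLen S(Z)/2^m + 1)` (Part 4, the scaling property of `…B16SProfile` along the flow shifted by one step —
the merged body `Z` of touching pieces need not be face-connected, its first iterate `S(Z)` is, Part 7).  Paying the fee
side for the first `j` scales and the decay side afterwards (a geometric tail) gives the amortised bound with slope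
`16·1122^d/2^j` — as small as desired — WITHOUT logarithms (Part 5); the merged horizon enters linearly and is linked
to `treeLen S(Z)` by the duration–size link of `…B16Overhang` transported to the first iterate (Part 6).

WHAT IS PROVED (unconditionally; every dimension `d`, every `L ≥ 2` (Parts 2–3, fee side) resp. `L ≥ 4` (decay side),
every exponent sequence `σ` with the drop control `DropCtl σ m'`, `q = ratio L σ`; time `0` = the merge scale `j + 1`;
pieces `B : ι → Finset (Pt d)` indexed by `S : Finset ι`, chosen cubes `b x ∈ B x`, death steps `a : ι → ℕ` (`x` alive at
`m` iff `m ≤ a x`) with `S^{a x}(B_x)` satisfying (i) for every piece dead before the horizon, `Z = ⋃_{x∈S} B_x`).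
* Part 1: `Z^{(i)} ⊆ S^{i}(Z)` (`closureIdx_Qprod_subset_Siter`); `Q_{n+1} = q₀·Q′_n` and
  `Z^{(n+1)} ⊆ (S(Z))′^{(n)}` along the shifted flow (`Qprod_succ_eq_mul_shift`, `closureIdx_Qprod_succ_subset`).
* Part 2: A DEAD PIECE IS BOXED: `S^{a+t}(B) ⊆ □(coarse_{Q_{a+t}} b, 280)` for every `b ∈ B`, `t` on the horizon
  (`Siter_subset_box_of_condI`; side `width + 2·shrink ≤ 280` by `B16Overhang.side_le_281`).
* Part 3: `#S^m(Z) ≤ Σ_{x alive} #S^m(B_x) + o_m` (`card_Siter_le_alive_add_overhangN`, the binder `hZ` of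
  `controlsAm_merge` in cube currency); `o_m ≤ #(dead union) ≤ 561^d·#anchors_m` (`overhangN_le_card_deadU`,
  `card_deadU_le`); `#anchors_m ≤ |S|` and `anchors_m ⊆ Z^{(m)}` (`card_anchors_le_card`, `anchors_subset_closureIdx`).
* Part 4: `#Z^{(m)} ≤ 2^d·(16·treeLen S(Z)/2^m + 1)` for `1 ≤ m` on the horizon, `S(Z)` face-connected
  (`card_closureIdx_le_decay`).
* Part 5: `o_m ≤ 561^d·|S|` (`overhangN_le_card`), `o_m ≤ 1122^d·(16·treeLen S(Z)/2^m + 1)` (`overhangN_le_decay`),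
  `Σ_{j<m≤K} 2^{−m} ≤ 2^{−j}` (`sum_Ioc_inv_two_pow_le`), and THE AMORTISED SUM, for every horizon `K ≤ m'` and EVERY `j`:
  `Σ_{0<m≤K} o_m ≤ 561^d·|S|·j + 1122^d·(K + 16·treeLen S(Z)/2^j)` (`sum_overhangN_le`).
* Part 6: the duration–size link from the first iterate: `¬(i)` at step `i ≥ 1` ⇒ `2^i ≤ 4·treeLen S(Z)`
  (`two_pow_le_of_not_condI₁`), hence `2^{K−N} ≤ 4·treeLen S(Z)` for the least stopping index `K ≥ N+1` of `Z`
  (`two_pow_find_sub_le₁`); with `K ≤ N + T`, `2^T ≤ 2(2·treeLen S(Z) + 1)`, for every `j, k`: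
  `Σ_{0<m≤K} o_m ≤ 561^d·|S|·j + 1122^d·(N+k) + 1122^d·((k+2)/2^k)·(2·treeLen S(Z)+1) + 1122^d·16·treeLen S(Z)/2^j`
  (`sum_overhangN_amortised`).
* Part 7 (discharging the hypotheses): the collar of a TOUCH-connected family is face-connected
  (`faceConnected_collar_of_touchConnected`), coarsening preserves touch-connectedness (`touchConnected_closureIdx`),
  hence `S(Z)` IS FACE-CONNECTED FOR TOUCH-CONNECTED `Z` (`faceConnected_Sop_of_touchConnected`); `#S(X) ≤ 21^d·#X`
  (`card_Sop_le`), `treeLen S(Z) + 1 ≤ 21^d·Σ_x #B_x` (`treeLen_Sop_biUnion_le`); and THE `N`-ARY (G-AMORT) FOR A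
  TOUCH-CONNECTED MERGER in the cube currency of the pieces at the merge scale (`sum_overhangN_amortised_touch`):
  `Σ_{0<m≤K} o_m ≤ |S|·561^d·j + 1122^d·(N+k) + 1122^d·21^d·(2(k+2)/2^k + 16/2^j)·Σ_{x∈S} #B_x` for EVERY `j, k`.
  READING (with the weights `w_m ≤ W`, `W ≤ L^{d+1}·O(1)M^dR_{j+1}^{d+1}` of `B16Overhang.weighted_sum_le` /
  `Step.Budget.RStepLe`): slope `η = W·1122^d·21^d·(2(k+2)/2^k + 16/2^j)` as small as desired, fee `W·561^d·j` per
  piece (`|S| ≤ 2(|S|−1)` for a genuine merger) and `W·1122^d·(N+k)` per merger, `N = R_{j+1}` — the shape of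
  print's remainder `O(1)2(100M)^dR^{d+2}_{j+1}` in (1.88) (= `R_{j+1}` memory steps × `2·100^d` cubes × the weight
  `O(1)M^dR^{d+1}_{j+1}`) up to the constants.

WHAT IS NOT PROVED HERE (located, cell `GAPS.md` G-b02g11-1).  (a) The currency and the weights: sizes are CUBE COUNTS
(of the iterates for `o_m`, of the pieces at the merge scale on the right); print's `d′_n` is comparable up to the
constants of `TreeLength.card_le_treeLen` / `treeLen_le_card_sub_one` and the gluing constants of `…B16MergeGeometry`
(`DIVERGENCE.md` D-b02g9.3, D-b02g11.1); the `θ`-bookkeeping and the assembly into (1.80) are `…StepInhabited`'s.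
(b) The death steps: `a x` is whatever step the consumer retires piece `x` at (its least stopping index in print); the
only input is condition (i) for `S^{a x}(B_x)` — condition (ii) and the cleanliness parameter `Clean` of
`…B16StoppingRule` enter only through Part 6's link for `Z` (step `K − N` clean, as in `…B16Overhang` Part 1).
(c) The constants `561^d`, `1122^d`, `21^d`, `16` are not optimised (print: `2·100^d`).
-/

namespace Literature.MathematicalPhysics.QuantumFieldTheory.Balaban1983to89.B16OverhangN

open Literature.MathematicalPhysics.QuantumFieldTheory.Balaban1983to89
open Literature.MathematicalPhysics.QuantumFieldTheory.Balaban1983to89.B13ScaleTransfer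
open Literature.MathematicalPhysics.QuantumFieldTheory.Balaban1983to89.B16SProfile
open Literature.MathematicalPhysics.QuantumFieldTheory.Balaban1983to89.B16MergeGeometry
open Literature.MathematicalPhysics.QuantumFieldTheory.Balaban1983to89.B16Absorption
open Literature.MathematicalPhysics.QuantumFieldTheory.Balaban1983to89.B16StoppingRule
open Literature.MathematicalPhysics.QuantumFieldTheory.Balaban1983to89.B16MergeHorizon
open Literature.MathematicalPhysics.QuantumFieldTheory.Balaban1983to89.B16Overhang
open Literature.MathematicalPhysics.QuantumFieldTheory.Balaban1983to89.TreeLength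

variable {d : ℕ}

section

/-! ## Part 1. The coarse image of a set lies in its iterate; the ratio product splits off its first factor -/

/-- `Z^{(i)} ⊆ S^{i}(Z)`: the cover of `Z` by the cubes of the `i`-th partition lies in the `i`-th iterate. [folklore] -/
theorem closureIdx_Qprod_subset_Siter (q : ℕ → ℕ) : ∀ (i : ℕ) (Z : Finset (Pt d)),
    closureIdx (Qprod q i) Z ⊆ Siter q i Z
  | 0, Z => by simp [closureIdx_one]
  | i + 1, Z => by
    rw [closureIdx_Qprod_succ, Siter_succ]
    exact (Finset.image_subset_image (closureIdx_Qprod_subset_Siter q i Z)).trans (subset_iterate_collar 10 _)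

/-- `Q_{n+1} = q₀ · Q′_n` for the shifted sequence `q′_l = q_{1+l}`. [folklore] -/
theorem Qprod_succ_eq_mul_shift (q : ℕ → ℕ) : ∀ n : ℕ, Qprod q (n + 1) = q 0 * Qprod (fun l => q (1 + l)) n
  | 0 => by simp [Qprod_succ]
  | n + 1 => by
    rw [Qprod_succ, Qprod_succ_eq_mul_shift q n, Qprod_succ, Nat.add_comm 1 n, Nat.mul_assoc]

/-- The cover by the `(n+1)`-st partition lies in the cover of `S(Z)` by the `n`-th partition of the shifted flow.
[folklore] -/
theorem closureIdx_Qprod_succ_subset (q : ℕ → ℕ) (n : ℕ) (Z : Finset (Pt d)) :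
    closureIdx (Qprod q (n + 1)) Z ⊆ closureIdx (Qprod (fun l => q (1 + l)) n) (Sop (q 0) Z) := by
  rw [Qprod_succ_eq_mul_shift, ← closureIdx_closureIdx]
  exact Finset.image_subset_image (subset_iterate_collar 10 _)

/-! ## Part 2. A DEAD piece stays in a box of radius `280` about the coarse image of ANY of its cubes -/

/-- If `S^{a}(B)` satisfies (i) then for every later step `a + t` on the horizon and every cube `b ∈ B`,
`S^{a+t}(B) ⊆ □(coarse_{Q_{a+t}} b, 280)`: the orbit box has side `≤ width + 2·shrink ≤ 280` and contains the coarse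
image of `b`. [cite: Balaban1989LargeFieldII, p.387 l.8-15] -/
theorem Siter_subset_box_of_condI {L : ℕ} (hL : 2 ≤ L) {σ : ℕ → ℕ} {m' : ℕ} (hσ : DropCtl σ m')
    {B : Finset (Pt d)} {b : Pt d} (hb : b ∈ B) {a : ℕ} (hI : CondI 100 (Siter (ratio L σ) a B)) (t : ℕ)
    (ht : a + t ≤ m') :
    Siter (ratio L σ) (a + t) B ⊆ box (coarse (Qprod (ratio L σ) (a + t)) b) 280 := by
  have hq : ∀ l, 0 < ratio L σ l := fun l => ratio_pos (by omega) σ l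
  obtain ⟨y, hy⟩ := Siter_nonempty (ratio L σ) ⟨b, hb⟩ a
  have hX := near_of_condI_touch hI hy (Touch.refl y)
  have hq' : ∀ l, 0 < ratio L (fun n => σ (a + n)) l := fun l => ratio_pos (by omega) _ l
  have halt := altGain_ratio hL (dropCtl_shift hσ a)
  have hside := side_le_281 hq' halt (by norm_num : (0:ℤ) ≤ 100) (by norm_num) t (by omega)
  have hside' : width (ratio L (fun n => σ (a + n))) t + 2 * shrink (ratio L (fun n => σ (a + n))) 100 t ≤ 280 := by
    have := Int.toNat_le.mp hside
    push_cast at this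
    omega
  have hP : Siter (ratio L σ) (a + t) B ⊆
      pbox (fun i => envLo (ratio L (fun n => σ (a + n))) (y i) t - shrink (ratio L (fun n => σ (a + n))) 100 t)
           (fun i => env (ratio L (fun n => σ (a + n))) (y i) t + shrink (ratio L (fun n => σ (a + n))) 100 t) := by
    rw [Siter_add, ratio_shift_fun]
    exact Siter_subset_pbox_of_near hq' hX t
  have hp : coarse (Qprod (ratio L σ) (a + t)) b ∈ Siter (ratio L σ) (a + t) B :=
    closureIdx_Qprod_subset_Siter _ _ _ (Finset.mem_image_of_mem _ hb)
  have hpP := mem_pbox.1 (hP hp)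
  intro w hw
  have hwP := mem_pbox.1 (hP hw)
  rw [mem_box]
  intro i
  obtain ⟨h1, h2⟩ := hpP i
  obtain ⟨h3, h4⟩ := hwP i
  have hwid := env_sub_envLo_le_width hq' (y i) t
  push_cast
  constructor <;> omega

/-! ## Part 3. The `N`-ary merger: dead union, anchors, the overhang profile -/

variable {ι : Type*}

/-- The union of the iterates of the pieces DEAD at step `m` (`x` is alive at `m` iff `m ≤ a x`). Cell bookkeeping,
NOT A PRINTED NOTION. [folklore] -/
noncomputable def deadU (q : ℕ → ℕ) (S : Finset ι) (B : ι → Finset (Pt d)) (a : ι → ℕ) (m : ℕ) : Finset (Pt d) :=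
  (S.filter fun x => a x < m).biUnion fun x => Siter q m (B x)

/-- The ANCHORS at step `m`: the coarse images of the chosen cubes `b x` of the dead pieces. Cell bookkeeping,
NOT A PRINTED NOTION. [folklore] -/
def anchors (q : ℕ → ℕ) (S : Finset ι) (b : ι → Pt d) (a : ι → ℕ) (m : ℕ) : Finset (Pt d) :=
  (S.filter fun x => a x < m).image fun x => coarse (Qprod q m) (b x)

/-- The `N`-ary DEAD OVERHANG PROFILE in cube currency: the cubes of `S^{m}(Z)`, `Z = ⋃_{x ∈ S} B_x`, outside the
iterate of the union of the pieces alive at `m`. Cell bookkeeping, NOT A PRINTED NOTION (print asserts no overhang).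
[folklore] -/
noncomputable def overhangN (q : ℕ → ℕ) (S : Finset ι) (B : ι → Finset (Pt d)) (a : ι → ℕ) (m : ℕ) : ℕ :=
  (Siter q m (S.biUnion B)).card - (Siter q m ((S.filter fun x => m ≤ a x).biUnion B)).card

/-- The binder `hZ` of `Step.Budget.controlsAm_merge` in cube currency: `#S^m(Z) ≤ Σ_{x alive at m} #S^m(B_x) + o_m`.
[folklore] -/
theorem card_Siter_le_alive_add_overhangN (q : ℕ → ℕ) (S : Finset ι) (B : ι → Finset (Pt d)) (a : ι → ℕ)
    (m : ℕ) : (Siter q m (S.biUnion B)).card ≤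
      (∑ x ∈ S.filter (fun x => m ≤ a x), (Siter q m (B x)).card) + overhangN q S B a m := by
  have h1 : (Siter q m ((S.filter fun x => m ≤ a x).biUnion B)).card ≤
      ∑ x ∈ S.filter (fun x => m ≤ a x), (Siter q m (B x)).card := by
    rw [Siter_biUnion]; exact Finset.card_biUnion_le
  unfold overhangN
  omega

/-- `S^m(Z) ⊆ S^m(Z_alive) ∪ (dead union)`. [folklore] -/
theorem Siter_subset_alive_union_deadU (q : ℕ → ℕ) (S : Finset ι) (B : ι → Finset (Pt d)) (a : ι → ℕ) (m : ℕ) :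
    Siter q m (S.biUnion B) ⊆ Siter q m ((S.filter fun x => m ≤ a x).biUnion B) ∪ deadU q S B a m := by
  intro w hw
  rw [Siter_biUnion, Finset.mem_biUnion] at hw
  obtain ⟨x, hx, hwx⟩ := hw
  rw [Finset.mem_union]
  by_cases hax : m ≤ a x
  · left
    rw [Siter_biUnion, Finset.mem_biUnion]
    exact ⟨x, Finset.mem_filter.2 ⟨hx, hax⟩, hwx⟩
  · right
    unfold deadU
    rw [Finset.mem_biUnion]
    exact ⟨x, Finset.mem_filter.2 ⟨hx, by omega⟩, hwx⟩

/-- The overhang is at most the size of the dead union. [folklore] -/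
theorem overhangN_le_card_deadU (q : ℕ → ℕ) (S : Finset ι) (B : ι → Finset (Pt d)) (a : ι → ℕ) (m : ℕ) :
    overhangN q S B a m ≤ (deadU q S B a m).card := by
  have h := (Finset.card_le_card (Siter_subset_alive_union_deadU q S B a m)).trans (Finset.card_union_le _ _)
  unfold overhangN
  omega

/-- THE COALESCENCE BOUND: the dead union lies in the union of the radius-`280` boxes about the anchors, hence
`#(dead union) ≤ 561^d · #anchors` — dead pieces whose chosen cubes have the same coarse image cost ONCE.
[cite: Balaban1989LargeFieldII, p.387 l.8-15] -/
theorem card_deadU_le {L : ℕ} (hL : 2 ≤ L) {σ : ℕ → ℕ} {m' : ℕ} (hσ : DropCtl σ m')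
    {S : Finset ι} {B : ι → Finset (Pt d)} {b : ι → Pt d} {a : ι → ℕ} (hb : ∀ x ∈ S, b x ∈ B x) {m : ℕ}
    (hI : ∀ x ∈ S, a x < m → CondI 100 (Siter (ratio L σ) (a x) (B x))) (hm : m ≤ m') :
    (deadU (ratio L σ) S B a m).card ≤ 561 ^ d * (anchors (ratio L σ) S b a m).card := by
  have hsub : deadU (ratio L σ) S B a m ⊆ (anchors (ratio L σ) S b a m).biUnion fun p => box p 280 := by
    intro w hw
    unfold deadU at hw
    rw [Finset.mem_biUnion] at hw
    obtain ⟨x, hx, hwx⟩ := hw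
    rw [Finset.mem_filter] at hx
    rw [Finset.mem_biUnion]
    refine ⟨coarse (Qprod (ratio L σ) m) (b x), Finset.mem_image_of_mem _ (Finset.mem_filter.2 hx), ?_⟩
    have hm' : a x + (m - a x) = m := by omega
    have h := Siter_subset_box_of_condI hL hσ (hb x hx.1) (hI x hx.1 hx.2) (m - a x) (by omega)
    rw [hm'] at h
    exact h hwx
  calc (deadU (ratio L σ) S B a m).card ≤ ((anchors (ratio L σ) S b a m).biUnion fun p => box p 280).card :=
        Finset.card_le_card hsub
    _ ≤ ∑ p ∈ anchors (ratio L σ) S b a m, (box p 280).card := Finset.card_biUnion_le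
    _ = ∑ p ∈ anchors (ratio L σ) S b a m, 561 ^ d := by simp [card_box]
    _ = 561 ^ d * (anchors (ratio L σ) S b a m).card := by rw [Finset.sum_const, smul_eq_mul, Nat.mul_comm]

/-- At most one anchor per dead piece. [folklore] -/
theorem card_anchors_le_card (q : ℕ → ℕ) (S : Finset ι) (b : ι → Pt d) (a : ι → ℕ) (m : ℕ) :
    (anchors q S b a m).card ≤ S.card :=
  Finset.card_image_le.trans (Finset.card_filter_le _ _)

/-- The anchors lie in the cover of `Z` by the cubes of the `m`-th partition. [folklore] -/
theorem anchors_subset_closureIdx (q : ℕ → ℕ) {S : Finset ι} {B : ι → Finset (Pt d)} {b : ι → Pt d}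
    (hb : ∀ x ∈ S, b x ∈ B x) (a : ι → ℕ) (m : ℕ) :
    anchors q S b a m ⊆ closureIdx (Qprod q m) (S.biUnion B) := by
  intro p hp
  unfold anchors at hp
  rw [Finset.mem_image] at hp
  obtain ⟨x, hx, rfl⟩ := hp
  rw [Finset.mem_filter] at hx
  exact Finset.mem_image_of_mem _ (Finset.mem_biUnion.2 ⟨x, hx.1, hb x hx.1⟩)

/-! ## Part 4. The cover of `Z` by the `m`-th partition has `≤ 2^d(16·treeLen S(Z)/2^m + 1)` cubes -/

/-- DECAY OF THE COVER COUNT: for `1 ≤ m` on the horizon, `#Z^{(m)} ≤ 2^d·(16·treeLen(S(Z))/2^m + 1)` whenever `S(Z)` is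
face-connected (`L ≥ 4`; `TreeLength.card_le_treeLen` and the scaling property `B16SProfile.half_pow_mul_treeLen_ge`
along the flow shifted by one step). [cite: Balaban1989LargeFieldII, p.385 l.1-5] -/
theorem card_closureIdx_le_decay {L : ℕ} (hL : 4 ≤ L) {σ : ℕ → ℕ} {m' : ℕ} (hσ : DropCtl σ m')
    {Z : Finset (Pt d)} (hZ : Z.Nonempty) (hZ₁c : FaceConnected (Sop (ratio L σ 0) Z)) {m : ℕ} (hm1 : 1 ≤ m)
    (hm : m ≤ m') :
    ((closureIdx (Qprod (ratio L σ) m) Z).card : ℝ) ≤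
      2 ^ d * (16 * treeLen (Sop (ratio L σ 0) Z) / 2 ^ m + 1) := by
  obtain ⟨n, rfl⟩ : ∃ n, m = n + 1 := ⟨m - 1, by omega⟩
  set Z₁ := Sop (ratio L σ 0) Z with hZ₁
  have hZ₁ne : Z₁.Nonempty := Sop_nonempty _ hZ
  set W := closureIdx (Qprod (ratio L (fun k => σ (1 + k))) n) Z₁ with hW
  have hsub : closureIdx (Qprod (ratio L σ) (n + 1)) Z ⊆ W := by
    have h := closureIdx_Qprod_succ_subset (ratio L σ) n Z
    rw [ratio_shift_fun] at h
    exact h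
  have hq' : ∀ l, 0 < ratio L (fun k => σ (1 + k)) l := fun l => ratio_pos (by omega) _ l
  have hWne : W.Nonempty := closureIdx_nonempty hZ₁ne
  have hWc : FaceConnected W := faceConnected_closureIdx (Qprod_pos hq' n) hZ₁c
  have h1 : ((closureIdx (Qprod (ratio L σ) (n + 1)) Z).card : ℝ) ≤ W.card := by
    exact_mod_cast Finset.card_le_card hsub
  have h2 := card_le_treeLen hWne hWc
  have hT : 0 ≤ treeLen Z₁ := treeLen_nonneg _
  have h3 : 4 * treeLen W ≤ 16 * treeLen Z₁ / 2 ^ (n + 1) := by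
    rcases Nat.eq_zero_or_pos n with hn | hn
    · subst hn
      have : W = Z₁ := by rw [hW, Qprod_zero, closureIdx_one]
      rw [this, pow_one]
      linarith
    · have h4 := half_pow_mul_treeLen_ge hL (dropCtl_shift hσ 1) hZ₁ne hZ₁c hn (by omega : n ≤ m' - 1)
      rw [← hW] at h4
      have h5 : (16 : ℝ) * treeLen Z₁ / 2 ^ (n + 1) = 8 * ((1 / 2 : ℝ) ^ n * treeLen Z₁) := by
        rw [pow_succ, one_div_pow]
        field_simp
        ring
      rw [h5]
      linarith
  have h2d : (0 : ℝ) ≤ 2 ^ d := by positivity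
  calc ((closureIdx (Qprod (ratio L σ) (n + 1)) Z).card : ℝ) ≤ W.card := h1
    _ ≤ 2 ^ d * (4 * treeLen W + 1) := h2
    _ ≤ 2 ^ d * (16 * treeLen Z₁ / 2 ^ (n + 1) + 1) := mul_le_mul_of_nonneg_left (by linarith) h2d

/-! ## Part 5. Per-scale bounds of the overhang and THE AMORTISED SUM (fee per piece × `j` scales + decayed tail) -/

/-- FEE SIDE: `o_m ≤ 561^d · |S|` at every step on the horizon (`L ≥ 2`). [folklore] -/
theorem overhangN_le_card {L : ℕ} (hL : 2 ≤ L) {σ : ℕ → ℕ} {m' : ℕ} (hσ : DropCtl σ m')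
    {S : Finset ι} {B : ι → Finset (Pt d)} {b : ι → Pt d} {a : ι → ℕ} (hb : ∀ x ∈ S, b x ∈ B x) {m : ℕ}
    (hI : ∀ x ∈ S, a x < m → CondI 100 (Siter (ratio L σ) (a x) (B x))) (hm : m ≤ m') :
    overhangN (ratio L σ) S B a m ≤ 561 ^ d * S.card :=
  (overhangN_le_card_deadU _ S B a m).trans ((card_deadU_le hL hσ hb hI hm).trans
    (Nat.mul_le_mul_left _ (card_anchors_le_card _ S b a m)))

/-- DECAY SIDE: `o_m ≤ 1122^d · (16·treeLen S(Z)/2^m + 1)` for `1 ≤ m` on the horizon (`L ≥ 4`, `S(Z)` face-connected).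
[cite: Balaban1989LargeFieldII, p.385 l.1-5] -/
theorem overhangN_le_decay {L : ℕ} (hL : 4 ≤ L) {σ : ℕ → ℕ} {m' : ℕ} (hσ : DropCtl σ m')
    {S : Finset ι} {B : ι → Finset (Pt d)} {b : ι → Pt d} {a : ι → ℕ} (hb : ∀ x ∈ S, b x ∈ B x) {m : ℕ}
    (hI : ∀ x ∈ S, a x < m → CondI 100 (Siter (ratio L σ) (a x) (B x))) (hS : S.Nonempty)
    (hZ₁c : FaceConnected (Sop (ratio L σ 0) (S.biUnion B))) (hm1 : 1 ≤ m) (hm : m ≤ m') :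
    (overhangN (ratio L σ) S B a m : ℝ) ≤
      1122 ^ d * (16 * treeLen (Sop (ratio L σ 0) (S.biUnion B)) / 2 ^ m + 1) := by
  have hZ : (S.biUnion B).Nonempty := by
    obtain ⟨x, hx⟩ := hS
    exact ⟨b x, Finset.mem_biUnion.2 ⟨x, hx, hb x hx⟩⟩
  have h1 : (overhangN (ratio L σ) S B a m : ℝ) ≤ 561 ^ d * (anchors (ratio L σ) S b a m).card := by
    exact_mod_cast (overhangN_le_card_deadU _ S B a m).trans (card_deadU_le (by omega) hσ hb hI hm)
  have h2 : ((anchors (ratio L σ) S b a m).card : ℝ) ≤ (closureIdx (Qprod (ratio L σ) m) (S.biUnion B)).card := by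
    exact_mod_cast Finset.card_le_card (anchors_subset_closureIdx _ hb a m)
  have h3 := card_closureIdx_le_decay hL hσ hZ hZ₁c hm1 hm
  have h4 : (0 : ℝ) ≤ 561 ^ d := by positivity
  have h5 : (1122 : ℝ) ^ d = 561 ^ d * 2 ^ d := by rw [← mul_pow]; norm_num
  calc (overhangN (ratio L σ) S B a m : ℝ) ≤ 561 ^ d * (anchors (ratio L σ) S b a m).card := h1
    _ ≤ 561 ^ d * (2 ^ d * (16 * treeLen (Sop (ratio L σ 0) (S.biUnion B)) / 2 ^ m + 1)) :=
        mul_le_mul_of_nonneg_left (h2.trans h3) h4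
    _ = 1122 ^ d * (16 * treeLen (Sop (ratio L σ 0) (S.biUnion B)) / 2 ^ m + 1) := by rw [h5]; ring

/-- The geometric tail: `Σ_{j < m ≤ K} 2^{−m} = 2^{−j} − 2^{−K}` (`j ≤ K`). [folklore] -/
theorem sum_Ioc_inv_two_pow_eq {j K : ℕ} (h : j ≤ K) :
    ∑ m ∈ Finset.Ioc j K, (1 : ℝ) / 2 ^ m = 1 / 2 ^ j - 1 / 2 ^ K := by
  induction K, h using Nat.le_induction with
  | base => simp
  | succ K hK ih =>
    rw [Finset.sum_Ioc_succ_top hK, ih, pow_succ]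
    field_simp
    ring

/-- `Σ_{j < m ≤ K} 2^{−m} ≤ 2^{−j}`. [folklore] -/
theorem sum_Ioc_inv_two_pow_le (j K : ℕ) : ∑ m ∈ Finset.Ioc j K, (1 : ℝ) / 2 ^ m ≤ 1 / 2 ^ j := by
  rcases Nat.lt_or_ge K j with h | h
  · rw [Finset.Ioc_eq_empty (by omega), Finset.sum_empty]
    positivity
  · rw [sum_Ioc_inv_two_pow_eq h]
    have : (0 : ℝ) ≤ 1 / 2 ^ K := by positivity
    linarith

/-- THE `N`-ARY AMORTISED OVERHANG BOUND: for pieces `B_x` (`x ∈ S`) with chosen cubes `b x ∈ B_x`, each satisfying (i) at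
its death step `a x`, merged body `Z = ⋃ B_x` with `S(Z)` face-connected, every horizon `K` and EVERY `j`:
`Σ_{0 < m ≤ K} o_m ≤ 561^d·|S|·j + 1122^d·(K + 16·treeLen S(Z)/2^j)` — a FEE of `561^d` per piece for `j` scales, a fee
`1122^d` per scale of the merged horizon, and a tail `1122^d·16/2^j · treeLen S(Z)` with coefficient AS SMALL AS DESIRED.
[cite: Balaban1989LargeFieldII, p.387 (1.88)] -/
theorem sum_overhangN_le {L : ℕ} (hL : 4 ≤ L) {σ : ℕ → ℕ} {m' : ℕ} (hσ : DropCtl σ m')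
    {S : Finset ι} {B : ι → Finset (Pt d)} {b : ι → Pt d} {a : ι → ℕ} (hb : ∀ x ∈ S, b x ∈ B x) {K : ℕ}
    (hI : ∀ x ∈ S, a x < K → CondI 100 (Siter (ratio L σ) (a x) (B x))) (hS : S.Nonempty)
    (hZ₁c : FaceConnected (Sop (ratio L σ 0) (S.biUnion B))) (hK : K ≤ m') (j : ℕ) :
    ((∑ m ∈ Finset.Ioc 0 K, overhangN (ratio L σ) S B a m : ℕ) : ℝ) ≤
      561 ^ d * S.card * j + 1122 ^ d * (K + 16 * treeLen (Sop (ratio L σ 0) (S.biUnion B)) / 2 ^ j) := by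
  set T₁ := treeLen (Sop (ratio L σ 0) (S.biUnion B)) with hT₁
  have hT : 0 ≤ T₁ := treeLen_nonneg _
  have hA : (0 : ℝ) ≤ 561 ^ d * S.card := by positivity
  have hC : (0 : ℝ) ≤ 1122 ^ d := by positivity
  let f : ℕ → ℝ := fun m => if m ≤ j then (561 : ℝ) ^ d * S.card else 1122 ^ d * (16 * T₁ / 2 ^ m + 1)
  have hterm : ∀ m ∈ Finset.Ioc 0 K, (overhangN (ratio L σ) S B a m : ℝ) ≤ f m := by
    intro m hm
    rw [Finset.mem_Ioc] at hm
    have hIm : ∀ x ∈ S, a x < m → CondI 100 (Siter (ratio L σ) (a x) (B x)) :=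
      fun x hx hax => hI x hx (by omega)
    by_cases hmj : m ≤ j
    · simp only [f, if_pos hmj]
      exact_mod_cast overhangN_le_card (by omega) hσ hb hIm (by omega : m ≤ m')
    · simp only [f, if_neg hmj]
      exact overhangN_le_decay hL hσ hb hIm hS hZ₁c (by omega) (by omega)
  have hsplit : ∑ m ∈ Finset.Ioc 0 K, f m =
      (∑ m ∈ (Finset.Ioc 0 K).filter (fun m => m ≤ j), (561 : ℝ) ^ d * S.card) +
      ∑ m ∈ (Finset.Ioc 0 K).filter (fun m => ¬ m ≤ j), 1122 ^ d * (16 * T₁ / 2 ^ m + 1) := Finset.sum_ite _ _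
  have hfirst : (∑ m ∈ (Finset.Ioc 0 K).filter (fun m => m ≤ j), (561 : ℝ) ^ d * S.card) ≤ 561 ^ d * S.card * j := by
    rw [Finset.sum_const, nsmul_eq_mul]
    have hc : ((Finset.Ioc 0 K).filter (fun m => m ≤ j)).card ≤ j := by
      calc ((Finset.Ioc 0 K).filter (fun m => m ≤ j)).card ≤ (Finset.Ioc 0 j).card := by
            apply Finset.card_le_card
            intro m hm
            simp only [Finset.mem_filter, Finset.mem_Ioc] at hm ⊢
            omega
        _ = j := by simp
    have hc' : (((Finset.Ioc 0 K).filter (fun m => m ≤ j)).card : ℝ) ≤ j := by exact_mod_cast hc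
    nlinarith
  have hIoc : (Finset.Ioc 0 K).filter (fun m => ¬ m ≤ j) = Finset.Ioc j K := by
    ext m
    simp only [Finset.mem_filter, Finset.mem_Ioc]
    omega
  have hsecond : ∑ m ∈ (Finset.Ioc 0 K).filter (fun m => ¬ m ≤ j), (1122 : ℝ) ^ d * (16 * T₁ / 2 ^ m + 1) ≤
      1122 ^ d * (K + 16 * T₁ / 2 ^ j) := by
    rw [hIoc, ← Finset.mul_sum, Finset.sum_add_distrib, Finset.sum_const, nsmul_eq_mul, mul_one, Nat.card_Ioc]
    have hg := sum_Ioc_inv_two_pow_le j K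
    have h16 : ∑ m ∈ Finset.Ioc j K, (16 : ℝ) * T₁ / 2 ^ m = 16 * T₁ * ∑ m ∈ Finset.Ioc j K, (1 : ℝ) / 2 ^ m := by
      rw [Finset.mul_sum]
      refine Finset.sum_congr rfl fun m _ => ?_
      field_simp
    rw [h16]
    have hKj : ((K - j : ℕ) : ℝ) ≤ K := by exact_mod_cast Nat.sub_le K j
    have h16T : (0 : ℝ) ≤ 16 * T₁ := by positivity
    have := mul_le_mul_of_nonneg_left hg h16T
    apply mul_le_mul_of_nonneg_left _ hC
    have h17 : 16 * T₁ * (1 / (2 : ℝ) ^ j) = 16 * T₁ / 2 ^ j := by field_simp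
    linarith
  calc ((∑ m ∈ Finset.Ioc 0 K, overhangN (ratio L σ) S B a m : ℕ) : ℝ)
      = ∑ m ∈ Finset.Ioc 0 K, (overhangN (ratio L σ) S B a m : ℝ) := by push_cast; rfl
    _ ≤ ∑ m ∈ Finset.Ioc 0 K, f m := Finset.sum_le_sum hterm
    _ ≤ 561 ^ d * S.card * j + 1122 ^ d * (K + 16 * T₁ / 2 ^ j) := by rw [hsplit]; linarith

/-! ## Part 6. The merged horizon in terms of `treeLen S(Z)` (the body `Z` itself need not be face-connected) -/

/-- The duration–size link from the FIRST iterate: if `S^{i}(Z)` violates (i) for some `1 ≤ i` on the horizon and `S(Z)`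
is face-connected, then `2^i ≤ 4·treeLen S(Z)` (`L ≥ 4`). [cite: Balaban1989LargeFieldII, p.385 l.1-5] -/
theorem two_pow_le_of_not_condI₁ {L : ℕ} {σ : ℕ → ℕ} {m i : ℕ} (hL : 4 ≤ L) (h : DropCtl σ m)
    {Z : Finset (Pt d)} (hZ : Z.Nonempty) (hZ₁c : FaceConnected (Sop (ratio L σ 0) Z)) (hi1 : 1 ≤ i) (hi : i ≤ m)
    (hI : ¬ CondI 100 (Siter (ratio L σ) i Z)) : (2 : ℝ) ^ i ≤ 4 * treeLen (Sop (ratio L σ 0) Z) := by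
  obtain ⟨n, rfl⟩ : ∃ n, i = n + 1 := ⟨i - 1, by omega⟩
  have hZ₁ne : (Sop (ratio L σ 0) Z).Nonempty := Sop_nonempty _ hZ
  have hS1 : Siter (ratio L σ) 1 Z = Sop (ratio L σ 0) Z := by rw [Siter_succ, Siter_zero]
  have hI' : ¬ CondI 100 (Siter (ratio L (fun k => σ (1 + k))) n (Sop (ratio L σ 0) Z)) := by
    rw [← hS1, ← ratio_shift_fun, ← Siter_add, Nat.add_comm 1 n]
    exact hI
  rcases Nat.eq_zero_or_pos n with hn | hn
  · subst hn
    have h1 := one_le_treeLen_of_not_condI (by omega : 3 ≤ L) (dropCtl_shift h 1) hZ₁ne hZ₁c (Nat.zero_le _) hI'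
    rw [Qprod_zero, closureIdx_one] at h1
    norm_num
    linarith
  · have h2 := two_pow_le_of_not_condI hL (dropCtl_shift h 1) hZ₁ne hZ₁c hn (by omega : n ≤ m - 1) hI'
    rw [pow_succ]
    linarith

/-- For the least stopping index `K ≥ N + 1` of `Z` (memory `N ≥ 1`, step `K − N` clean and on the horizon):
`2^{K−N} ≤ 4·treeLen S(Z)`. [cite: Balaban1989LargeFieldII, p.384 (definition of K), p.385 l.1-5] -/
theorem two_pow_find_sub_le₁ {L : ℕ} {σ : ℕ → ℕ} {m : ℕ} (hL : 4 ≤ L) (h : DropCtl σ m)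
    {Z : Finset (Pt d)} (hZ : Z.Nonempty) (hZ₁c : FaceConnected (Sop (ratio L σ 0) Z)) {N : ℕ} {Clean : ℕ → Prop}
    (hN1 : 1 ≤ N) [DecidablePred (StopAt 100 N Clean (fun l => Siter (ratio L σ) l Z))]
    (hex : ∃ K, StopAt 100 N Clean (fun l => Siter (ratio L σ) l Z) K)
    (hNK : N + 1 ≤ Nat.find hex) (hcl : Clean (Nat.find hex - N)) (hm : Nat.find hex - N ≤ m) :
    (2 : ℝ) ^ (Nat.find hex - N) ≤ 4 * treeLen (Sop (ratio L σ 0) Z) :=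
  two_pow_le_of_not_condI₁ hL h hZ hZ₁c (by omega) hm (not_condI_find_sub hex hN1 hNK hcl)

/-- THE `N`-ARY (G-AMORT) IN THE INDEX MODEL, cube currency, unit weights: with the merged horizon `K ≤ N + T`,
`2^T ≤ 2(2·treeLen S(Z) + 1)` (Part 6 / `two_pow_find_sub_le₁`), for EVERY `j` and EVERY `k`:
`Σ_{0 < m ≤ K} o_m ≤ |S|·(561^d·j) + 1122^d·(N + k) + 1122^d·((k+2)/2^k)·(2·treeLen S(Z) + 1) + 1122^d·16·treeLen S(Z)/2^j`.
READING: fee `561^d·j` per piece, fee `1122^d·(N + k + (k+2)/2^k)` (`≤ 1122^d·(N + k + 2)`; `≤ 1122^d·(N + k + 1)` once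
`k ≥ 2`) per merger, slope `η(j,k) = 1122^d·(2(k+2)/2^k + 16/2^j)` on
the size `treeLen S(Z)` — as small as desired. [cite: Balaban1989LargeFieldII, p.387 (1.88)] -/
theorem sum_overhangN_amortised {L : ℕ} (hL : 4 ≤ L) {σ : ℕ → ℕ} {m' : ℕ} (hσ : DropCtl σ m')
    {S : Finset ι} {B : ι → Finset (Pt d)} {b : ι → Pt d} {a : ι → ℕ} (hb : ∀ x ∈ S, b x ∈ B x) {K : ℕ}
    (hI : ∀ x ∈ S, a x < K → CondI 100 (Siter (ratio L σ) (a x) (B x))) (hS : S.Nonempty)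
    (hZ₁c : FaceConnected (Sop (ratio L σ 0) (S.biUnion B))) {N T : ℕ} (hK : K ≤ m') (hKT : K ≤ N + T)
    (hT : (2 : ℝ) ^ T ≤ 2 * (2 * treeLen (Sop (ratio L σ 0) (S.biUnion B)) + 1)) (j k : ℕ) :
    ((∑ m ∈ Finset.Ioc 0 K, overhangN (ratio L σ) S B a m : ℕ) : ℝ) ≤
      561 ^ d * S.card * j + 1122 ^ d * (N + k)
        + 1122 ^ d * ((k + 2) / 2 ^ k) * (2 * treeLen (Sop (ratio L σ 0) (S.biUnion B)) + 1)
        + 1122 ^ d * (16 * treeLen (Sop (ratio L σ 0) (S.biUnion B)) / 2 ^ j) := by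
  set T₁ := treeLen (Sop (ratio L σ 0) (S.biUnion B)) with hT₁
  have hT0 : 0 ≤ T₁ := treeLen_nonneg _
  have h1 := sum_overhangN_le hL hσ hb hI hS hZ₁c hK j
  rw [← hT₁] at h1
  have h2 := le_add_div_of_two_pow_le (by positivity : (0 : ℝ) ≤ 2 * T₁) hT k
  have h3 : (K : ℝ) ≤ N + T := by exact_mod_cast hKT
  have hC : (0 : ℝ) ≤ 1122 ^ d := by positivity
  have h4 : (1122 : ℝ) ^ d * (K + 16 * T₁ / 2 ^ j) ≤
      1122 ^ d * ((N + (k + (k + 2) / 2 ^ k * (2 * T₁ + 1))) + 16 * T₁ / 2 ^ j) :=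
    mul_le_mul_of_nonneg_left (by linarith) hC
  linarith

/-! ## Part 7. Discharging the hypotheses: `S(Z)` is face-connected for a TOUCH-connected `Z`; `treeLen S(Z)` against the
cube counts of the pieces -/

/-- The collar of a touch-connected family is face-connected: the blocks of two touching cubes share a cube. [folklore] -/
theorem faceConnected_collar_of_touchConnected {W : Finset (Pt d)} (hW : TouchConnected W) :
    FaceConnected (collar W) := by
  have key : ∀ {u v : Pt d}, Relation.ReflTransGen (TouchStep W) u v → u ∈ W → Linked (collar W) u v := by
    intro u v huv hu
    induction huv with
    | refl => exact Relation.ReflTransGen.refl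
    | tail _ hbc ih =>
      rename_i b c _
      obtain ⟨hb, hc, hbc'⟩ := hbc
      set w : Pt d := fun i => max (b i) (c i) with hw
      have hwb : w ∈ B13ScaleTransfer.block b := by
        rw [mem_block]
        intro i
        obtain ⟨h1, h2⟩ := hbc' i
        have h3 := le_max_left (b i) (c i)
        have h4 : w i = max (b i) (c i) := rfl
        exact ⟨by omega, by rw [h4]; exact max_le (by omega) (by omega)⟩
      have hwc : w ∈ B13ScaleTransfer.block c := by
        rw [mem_block]
        intro i
        obtain ⟨h1, h2⟩ := hbc' i
        have h3 := le_max_right (b i) (c i)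
        have h4 : w i = max (b i) (c i) := rfl
        exact ⟨by omega, by rw [h4]; exact max_le (by omega) (by omega)⟩
      have h5 : Linked (collar W) b w := (linked_block_center hwb).mono (block_subset_collar hb)
      have h6 : Linked (collar W) w c := ((linked_block_center hwc).mono (block_subset_collar hc)).symm
      exact (ih.trans h5).trans h6
  intro x hx y hy
  obtain ⟨c, hc, hxc⟩ := mem_collar.1 hx
  obtain ⟨c', hc', hyc'⟩ := mem_collar.1 hy
  have h1 : Linked (collar W) x c := ((linked_block_center hxc).mono (block_subset_collar hc)).symm
  have h2 : Linked (collar W) c c' := key (hW c hc c' hc') hc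
  have h3 : Linked (collar W) c' y := (linked_block_center hyc').mono (block_subset_collar hc')
  exact (h1.trans h2).trans h3

/-- Coarsening preserves touch-connectedness (`B16MergeGeometry.touch_coarse`). [folklore] -/
theorem touchConnected_closureIdx {q : ℕ} (hq : 0 < q) {Z : Finset (Pt d)} (hZ : TouchConnected Z) :
    TouchConnected (closureIdx q Z) := by
  have key : ∀ {u v : Pt d}, Relation.ReflTransGen (TouchStep Z) u v →
      Relation.ReflTransGen (TouchStep (closureIdx q Z)) (coarse q u) (coarse q v) := by
    intro u v huv
    induction huv with
    | refl => exact Relation.ReflTransGen.refl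
    | tail _ hbc ih =>
      exact ih.tail ⟨Finset.mem_image_of_mem _ hbc.1, Finset.mem_image_of_mem _ hbc.2.1, touch_coarse hq hbc.2.2⟩
  intro a ha b hb
  obtain ⟨x, hx, rfl⟩ := Finset.mem_image.mp ha
  obtain ⟨y, hy, rfl⟩ := Finset.mem_image.mp hb
  exact key (hZ x hx y hy)

/-- `S(Z)` IS FACE-CONNECTED FOR A TOUCH-CONNECTED `Z` (`q ≥ 1`): the merged body of touching pieces need not be
face-connected, its first iterate is. [cite: Balaban1989LargeFieldII, p.387 l.3-6] -/
theorem faceConnected_Sop_of_touchConnected {q : ℕ} (hq : 0 < q) {Z : Finset (Pt d)} (hZ : TouchConnected Z) :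
    FaceConnected (Sop q Z) := by
  change FaceConnected (collar^[9 + 1] (closureIdx q Z))
  rw [Function.iterate_succ_apply]
  exact faceConnected_iterate_collar 9 (faceConnected_collar_of_touchConnected (touchConnected_closureIdx hq hZ))

/-- `#S(X) ≤ 21^d · #X`. [folklore] -/
theorem card_Sop_le (q : ℕ) (X : Finset (Pt d)) : (Sop q X).card ≤ 21 ^ d * X.card := by
  have h1 : Sop q X ⊆ (closureIdx q X).biUnion fun p => box p 10 := by
    unfold Sop
    conv_lhs => rw [← Finset.biUnion_singleton_eq_self (s := closureIdx q X)]
    rw [iterate_collar_biUnion]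
    exact Finset.biUnion_mono fun p _ => iterate_collar_singleton_subset_box p 10
  calc (Sop q X).card ≤ ((closureIdx q X).biUnion fun p => box p 10).card := Finset.card_le_card h1
    _ ≤ ∑ p ∈ closureIdx q X, (box p 10).card := Finset.card_biUnion_le
    _ = 21 ^ d * (closureIdx q X).card := by simp [card_box, Finset.sum_const, Nat.mul_comm]
    _ ≤ 21 ^ d * X.card := Nat.mul_le_mul_left _ Finset.card_image_le

/-- SIZE CONVERSION: `treeLen S(Z) + 1 ≤ 21^d · Σ_{x ∈ S} #B_x` for `Z = ⋃ B_x` with `S(Z)` face-connected (cube currency at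
the merge scale). [folklore] -/
theorem treeLen_Sop_biUnion_le (q : ℕ) {S : Finset ι} {B : ι → Finset (Pt d)} (hZ : (S.biUnion B).Nonempty)
    (hZ₁c : FaceConnected (Sop q (S.biUnion B))) :
    treeLen (Sop q (S.biUnion B)) + 1 ≤ 21 ^ d * ∑ x ∈ S, ((B x).card : ℝ) := by
  have h1 := treeLen_le_card_sub_one (Sop_nonempty q hZ) hZ₁c
  have h2 : (Sop q (S.biUnion B)).card ≤ 21 ^ d * ∑ x ∈ S, (B x).card :=
    (card_Sop_le q _).trans (Nat.mul_le_mul_left _ Finset.card_biUnion_le)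
  have h3 : ((Sop q (S.biUnion B)).card : ℝ) ≤ 21 ^ d * ∑ x ∈ S, ((B x).card : ℝ) := by exact_mod_cast h2
  linarith

/-- THE `N`-ARY (G-AMORT) FOR A TOUCH-CONNECTED MERGER, sizes in cubes of the pieces at the merge scale: with
`Ssz = Σ_{x ∈ S} #B_x`, the merged horizon `K ≤ N + T`, `2^T ≤ 2(2·treeLen S(Z) + 1)`, for EVERY `j, k`:
`Σ_{0 < m ≤ K} o_m ≤ |S|·561^d·j + 1122^d·(N + k) + 1122^d·21^d·(2(k+2)/2^k + 16/2^j)·Ssz`.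
[cite: Balaban1989LargeFieldII, p.387 (1.88)] -/
theorem sum_overhangN_amortised_touch {L : ℕ} (hL : 4 ≤ L) {σ : ℕ → ℕ} {m' : ℕ} (hσ : DropCtl σ m')
    {S : Finset ι} {B : ι → Finset (Pt d)} {b : ι → Pt d} {a : ι → ℕ} (hb : ∀ x ∈ S, b x ∈ B x) {K : ℕ}
    (hI : ∀ x ∈ S, a x < K → CondI 100 (Siter (ratio L σ) (a x) (B x))) (hS : S.Nonempty)
    (hZc : TouchConnected (S.biUnion B)) {N T : ℕ} (hK : K ≤ m') (hKT : K ≤ N + T)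
    (hT : (2 : ℝ) ^ T ≤ 2 * (2 * treeLen (Sop (ratio L σ 0) (S.biUnion B)) + 1)) (j k : ℕ) :
    ((∑ m ∈ Finset.Ioc 0 K, overhangN (ratio L σ) S B a m : ℕ) : ℝ) ≤
      561 ^ d * S.card * j + 1122 ^ d * (N + k)
        + 1122 ^ d * 21 ^ d * (2 * ((k + 2) / 2 ^ k) + 16 / 2 ^ j) * ∑ x ∈ S, ((B x).card : ℝ) := by
  have hq0 : 0 < ratio L σ 0 := ratio_pos (by omega) σ 0
  have hZ₁c := faceConnected_Sop_of_touchConnected hq0 hZc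
  have hZ : (S.biUnion B).Nonempty := by
    obtain ⟨x, hx⟩ := hS
    exact ⟨b x, Finset.mem_biUnion.2 ⟨x, hx, hb x hx⟩⟩
  have h1 := sum_overhangN_amortised hL hσ hb hI hS hZ₁c hK hKT hT j k
  have h2 := treeLen_Sop_biUnion_le (ratio L σ 0) hZ hZ₁c
  set T₁ := treeLen (Sop (ratio L σ 0) (S.biUnion B)) with hT₁
  set Ssz := ∑ x ∈ S, ((B x).card : ℝ) with hSsz
  have hT0 : 0 ≤ T₁ := treeLen_nonneg _
  have hC : (0 : ℝ) ≤ 1122 ^ d := by positivity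
  have hk : (0 : ℝ) ≤ (k + 2) / 2 ^ k := by positivity
  have hj : (0 : ℝ) ≤ 16 / 2 ^ j := by positivity
  have h3 : 2 * T₁ + 1 ≤ 2 * (21 ^ d * Ssz) := by linarith
  have h4 : 16 * T₁ / 2 ^ j ≤ 16 / 2 ^ j * (21 ^ d * Ssz) := by
    rw [div_mul_eq_mul_div]
    apply div_le_div_of_nonneg_right _ (by positivity)
    nlinarith
  have h5 : (1122 : ℝ) ^ d * ((k + 2) / 2 ^ k) * (2 * T₁ + 1) ≤ 1122 ^ d * ((k + 2) / 2 ^ k) * (2 * (21 ^ d * Ssz)) :=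
    mul_le_mul_of_nonneg_left h3 (by positivity)
  have h6 : (1122 : ℝ) ^ d * (16 * T₁ / 2 ^ j) ≤ 1122 ^ d * (16 / 2 ^ j * (21 ^ d * Ssz)) :=
    mul_le_mul_of_nonneg_left h4 hC
  have h7 : (1122 : ℝ) ^ d * ((k + 2) / 2 ^ k) * (2 * (21 ^ d * Ssz)) + 1122 ^ d * (16 / 2 ^ j * (21 ^ d * Ssz)) =
      1122 ^ d * 21 ^ d * (2 * ((k + 2) / 2 ^ k) + 16 / 2 ^ j) * Ssz := by ring
  linarith

end

end Literature.MathematicalPhysics.QuantumFieldTheory.Balaban1983to89.B16OverhangN
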